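import Summits.ResolutionOfSingularities.ResolutionOfSingularities.Theorems.RisoStrataRtdLocal
import Summits.ResolutionOfSingularities.ResolutionOfSingularities.Theorems.RisoStrataRtdUpperSemicontinuousEdim
import Summits.ResolutionOfSingularities.ResolutionOfSingularities.Theorems.RisoStrataRisoCentresResolveDirCalculus

/-!
# Route RisoStrata — crux `RisoCentresResolve` (stmt-ResolutionOfSingularities-18546), line `Sketch`:
# TOOLS for the `p`-cusp family (`…PCuspFamily.lean`): arcs by evaluation, Hahn-series order
# bookkeeping, the two "kill" lemmas, and the Frobenius identity `pc_frob` (registered sub-goal)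

Lead c2. Characteristic-free except `pc_frob`/`pc_charP_hahn` (`char k = p`).
* `pc_exists_arc` — a `k`-algebra map `B → k⟦t^ℚ⟧` for `B ⊆ k[X₀,X₁] ⊆ k(X₀,X₁)` from the
  evaluation `X₀ ↦ C c + X`, `X₁ ↦ Y`, with its values on polynomial elements.
* `pc_orderTop_*`, `pc_*_orderTop_*` — orders of powers, products, `C c + U`, `t^e a + r`.
* `pc_kill` — `Δ₂^p = Δ₀ Y^p + E Δ₁^p` with `v E = 0`, `v Y = y₀`, `v Δ₀ = e ≤ v Δ₁, v Δ₂` is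
  impossible when `p y₀ < e (p - 1)`; `pc_smallkill` — the expanded identity at order `pe`
  forces `u₂^p = c' u₁^p`.
* `pc_frob` — `(α P₂ - β P₂)^p = (α P₀ - β P₀)(α P₁)^p + (C c^p + β P₀)(α P₁ - β P₁)^p` for
  `k`-algebra maps `α, β` to the Hahn field whenever `P₂^p = (P₀ + c^p) P₁^p`.
Mathlib + tree only; no definitions, no named facts.
-/

noncomputable section

set_option linter.dupNamespace false

namespace Summit.ResolutionOfSingularities.ResolutionOfSingularities.Theorems

open Summit.ResolutionOfSingularities.ResolutionOfSingularities.Theses.RisoStrata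

section PCuspArcs

variable {k : Type} [Field k]

/-- The polynomial ring embeds in its fraction field (as `k`-algebras). -/
theorem pc_iota_injective :
    Function.Injective (IsScalarTower.toAlgHom k (MvPolynomial (Fin 2) k)
      (FractionRing (MvPolynomial (Fin 2) k))) :=
  IsFractionRing.injective (MvPolynomial (Fin 2) k) (FractionRing (MvPolynomial (Fin 2) k))

/-- Arc of `B ⊆ k[X₀,X₁] ⊆ k(X₀,X₁)` through the evaluation `X₀ ↦ C c + X`, `X₁ ↦ Y`. -/
theorem pc_exists_arc (c : k) (X Y : HahnSeries ℚ k)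
    (B : Subalgebra k (FractionRing (MvPolynomial (Fin 2) k)))
    (hB : B ≤ (IsScalarTower.toAlgHom k (MvPolynomial (Fin 2) k)
      (FractionRing (MvPolynomial (Fin 2) k))).range) :
    ∃ α : ↥B →ₐ[k] HahnSeries ℚ k, ∀ (b : ↥B) (q : MvPolynomial (Fin 2) k),
      (b : FractionRing (MvPolynomial (Fin 2) k)) =
        algebraMap (MvPolynomial (Fin 2) k) (FractionRing (MvPolynomial (Fin 2) k)) q →
      α b = MvPolynomial.aeval ![HahnSeries.C c + X, Y] q := by
  set ι := IsScalarTower.toAlgHom k (MvPolynomial (Fin 2) k) (FractionRing (MvPolynomial (Fin 2) k))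
    with hι
  set e := AlgEquiv.ofInjective ι pc_iota_injective with he
  refine ⟨(MvPolynomial.aeval ![HahnSeries.C c + X, Y]).comp
    ((e.symm : ↥ι.range →ₐ[k] MvPolynomial (Fin 2) k).comp (Subalgebra.inclusion hB)), ?_⟩
  intro b q hbq
  have hincl : Subalgebra.inclusion hB b = e q := by
    apply Subtype.ext
    rw [Subalgebra.coe_inclusion, he, AlgEquiv.ofInjective_apply]
    exact hbq
  rw [AlgHom.comp_apply, AlgHom.comp_apply, hincl]
  exact congrArg _ (e.symm_apply_apply q)

end PCuspArcs

section PCuspOrders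

variable {k : Type} [Field k]

/-- `v (x ^ n) = n • v x` in the Hahn field over a field. -/
theorem pc_orderTop_pow (x : HahnSeries ℚ k) (n : ℕ) : (x ^ n).orderTop = n • x.orderTop := by
  induction n with
  | zero => simp
  | succ n ih => rw [pow_succ, HahnSeries.orderTop_mul, ih, succ_nsmul]

/-- `v (C c + U) = 0` for a nonzero constant `c` and `v U > 0`. -/
theorem pc_orderTop_C_add {c : k} (hc : c ≠ 0) {U : HahnSeries ℚ k} (hU : 0 < U.orderTop) :
    (HahnSeries.C c + U).orderTop = 0 := by
  have hC : (HahnSeries.C c : HahnSeries ℚ k).orderTop = 0 := by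
    rw [HahnSeries.C_apply, HahnSeries.orderTop_single hc]; rfl
  rw [HahnSeries.orderTop_add_eq_left (hC.symm ▸ hU), hC]

/-- `C a * t^e b = t^e (a b)`. -/
theorem pc_C_mul_single (a b : k) (e : ℚ) :
    HahnSeries.C a * HahnSeries.single e b = HahnSeries.single e (a * b) := by
  rw [HahnSeries.C_apply, HahnSeries.single_mul_single, zero_add]

/-- `v (t^e a + r) = e` if `a ≠ 0` and `v r > e`. -/
theorem pc_orderTop_single_add {a : k} (ha : a ≠ 0) {e : ℚ} {r : HahnSeries ℚ k}
    (hr : (e : WithTop ℚ) < r.orderTop) : (HahnSeries.single e a + r).orderTop = e := by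
  have hs : (HahnSeries.single e a).orderTop = e := HahnSeries.orderTop_single ha
  rw [HahnSeries.orderTop_add_eq_left (hs.symm ▸ hr), hs]

/-- From `v (Δ - t^e a) > e` with `a ≠ 0`: `v Δ = e`. -/
theorem pc_orderTop_eq_of_sub_single {a : k} (ha : a ≠ 0) {e : ℚ} {Δ : HahnSeries ℚ k}
    (h : (e : WithTop ℚ) < (Δ - HahnSeries.single e a).orderTop) : Δ.orderTop = e := by
  have h' : (e : WithTop ℚ) < (-(HahnSeries.single e a) + Δ).orderTop := by
    rwa [neg_add_eq_sub]
  have hs : (HahnSeries.single e a).orderTop = e := HahnSeries.orderTop_single ha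
  have := HahnSeries.orderTop_add_eq_left (x := HahnSeries.single e a)
    (y := -(HahnSeries.single e a) + Δ) (hs.symm ▸ h')
  rwa [add_neg_cancel_left, hs] at this

/-- From `v (Δ - w) > e` and `v w ≥ e`: `v Δ ≥ e`. -/
theorem pc_le_orderTop_of_sub {e : ℚ} {Δ w : HahnSeries ℚ k} (hw : (e : WithTop ℚ) ≤ w.orderTop)
    (h : (e : WithTop ℚ) < (Δ - w).orderTop) : (e : WithTop ℚ) ≤ Δ.orderTop := by
  have h' := HahnSeries.min_orderTop_le_orderTop_add (x := Δ - w) (y := w)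
  rw [sub_add_cancel] at h'
  exact (le_min h.le hw).trans h'

/-- `v x > a`, `v y ≥ b` ⟹ `v (x y) > a + b`. -/
theorem pc_lt_orderTop_mul {x y : HahnSeries ℚ k} {a b : ℚ} (hx : (a : WithTop ℚ) < x.orderTop)
    (hy : (b : WithTop ℚ) ≤ y.orderTop) : ((a + b : ℚ) : WithTop ℚ) < (x * y).orderTop := by
  rw [HahnSeries.orderTop_mul, WithTop.coe_add]
  exact WithTop.add_lt_add_of_lt_of_le WithTop.coe_ne_top hx hy

/-- `v x ≥ a`, `v y ≥ b` ⟹ `v (x y) ≥ a + b`. -/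
theorem pc_le_orderTop_mul {x y : HahnSeries ℚ k} {a b : ℚ} (hx : (a : WithTop ℚ) ≤ x.orderTop)
    (hy : (b : WithTop ℚ) ≤ y.orderTop) : ((a + b : ℚ) : WithTop ℚ) ≤ (x * y).orderTop := by
  rw [HahnSeries.orderTop_mul, WithTop.coe_add]
  exact add_le_add hx hy

/-- `v x ≥ a` ⟹ `v (x ^ n) ≥ n a`. -/
theorem pc_le_orderTop_pow {x : HahnSeries ℚ k} {a : ℚ} (hx : (a : WithTop ℚ) ≤ x.orderTop) (n : ℕ) :
    (((n : ℚ) * a : ℚ) : WithTop ℚ) ≤ (x ^ n).orderTop := by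
  rw [pc_orderTop_pow, ← nsmul_eq_mul, WithTop.coe_nsmul]
  exact nsmul_le_nsmul_right hx n

/-- `v x = a` ⟹ `v (x ^ n) = n a`. -/
theorem pc_orderTop_pow_eq {x : HahnSeries ℚ k} {a : ℚ} (hx : x.orderTop = a) (n : ℕ) :
    (x ^ n).orderTop = (((n : ℚ) * a : ℚ) : WithTop ℚ) := by
  rw [pc_orderTop_pow, hx, ← nsmul_eq_mul, WithTop.coe_nsmul]

/-- **Large-order kill.** An identity `Δ₂^p = Δ₀ · Y^p + E · Δ₁^p` with `v E = 0`,
`v Y = y₀`, `v Δ₀ = e`, `v Δ₁ ≥ e`, `v Δ₂ ≥ e` is impossible once `p y₀ < e (p - 1)`. -/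
theorem pc_kill {p : ℕ} {Δ₀ Δ₁ Δ₂ Y E : HahnSeries ℚ k} {e y₀ : ℚ}
    (hstar : Δ₂ ^ p = Δ₀ * Y ^ p + E * Δ₁ ^ p) (hE : E.orderTop = 0) (hY : Y.orderTop = y₀)
    (h0 : Δ₀.orderTop = e) (h1 : (e : WithTop ℚ) ≤ Δ₁.orderTop) (h2 : (e : WithTop ℚ) ≤ Δ₂.orderTop)
    (hlt : (p : ℚ) * y₀ < e * (p - 1)) : False := by
  have hA : (Δ₀ * Y ^ p).orderTop = ((e + p * y₀ : ℚ) : WithTop ℚ) := by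
    rw [HahnSeries.orderTop_mul, pc_orderTop_pow_eq hY, h0, ← WithTop.coe_add]
  have hpe : ((e + p * y₀ : ℚ) : WithTop ℚ) < (((p : ℚ) * e : ℚ) : WithTop ℚ) := by
    have : e + p * y₀ < p * e := by linarith
    exact_mod_cast this
  have hB : (((p : ℚ) * e : ℚ) : WithTop ℚ) ≤ (E * Δ₁ ^ p).orderTop := by
    have h := pc_le_orderTop_mul (le_of_eq hE.symm) (pc_le_orderTop_pow h1 p)
    rwa [zero_add] at h
  have hR : (Δ₀ * Y ^ p + E * Δ₁ ^ p).orderTop = ((e + p * y₀ : ℚ) : WithTop ℚ) := by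
    rw [HahnSeries.orderTop_add_eq_left (hA.symm ▸ (hpe.trans_le hB)), hA]
  have hL : (((p : ℚ) * e : ℚ) : WithTop ℚ) ≤ (Δ₂ ^ p).orderTop := pc_le_orderTop_pow h2 p
  rw [hstar, hR] at hL
  exact absurd (hpe.trans_le hL) (lt_irrefl _)

/-- **Small-order kill.** The expanded Frobenius identity
`t^{pe} (u₂^p) + R₂ = Δ₀ · Yp + (C c' + U) · (t^{pe} (u₁^p) + R₁)` with `c' ≠ 0`, `v U > 0`,
`v (Δ₀ · Yp) > pe`, `v R₁ > pe`, `v R₂ > pe` forces `u₂^p = c' u₁^p`. -/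
theorem pc_smallkill {p : ℕ} {Δ₀ Yp U R₁ R₂ : HahnSeries ℚ k} {e : ℚ} {c' u₁ u₂ : k} (hc' : c' ≠ 0)
    (hstar : HahnSeries.single ((p : ℚ) * e) (u₂ ^ p) + R₂ =
      Δ₀ * Yp + (HahnSeries.C c' + U) * (HahnSeries.single ((p : ℚ) * e) (u₁ ^ p) + R₁))
    (hT : (((p : ℚ) * e : ℚ) : WithTop ℚ) < (Δ₀ * Yp).orderTop) (hU : 0 < U.orderTop)
    (hR₁ : (((p : ℚ) * e : ℚ) : WithTop ℚ) < R₁.orderTop)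
    (hR₂ : (((p : ℚ) * e : ℚ) : WithTop ℚ) < R₂.orderTop) :
    u₂ ^ p = c' * u₁ ^ p := by
  by_contra hne
  have key : HahnSeries.single ((p : ℚ) * e) (u₂ ^ p - c' * u₁ ^ p) =
      Δ₀ * Yp + U * HahnSeries.single ((p : ℚ) * e) (u₁ ^ p) +
        ((HahnSeries.C c' + U) * R₁ + -R₂) := by
    rw [HahnSeries.single_sub, ← pc_C_mul_single c' (u₁ ^ p)]
    linear_combination hstar
  have hL : (HahnSeries.single ((p : ℚ) * e) (u₂ ^ p - c' * u₁ ^ p)).orderTop =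
      (((p : ℚ) * e : ℚ) : WithTop ℚ) :=
    HahnSeries.orderTop_single (sub_ne_zero.mpr hne)
  have hU0 : ((0 : ℚ) : WithTop ℚ) < U.orderTop := by simpa using hU
  have t2 : (((p : ℚ) * e : ℚ) : WithTop ℚ) < (U * HahnSeries.single ((p : ℚ) * e) (u₁ ^ p)).orderTop := by
    have h := pc_lt_orderTop_mul hU0 (HahnSeries.orderTop_single_le (a := (p : ℚ) * e) (r := u₁ ^ p))
    rwa [zero_add] at h
  have t3 : (((p : ℚ) * e : ℚ) : WithTop ℚ) < ((HahnSeries.C c' + U) * R₁).orderTop := by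
    rw [HahnSeries.orderTop_mul, pc_orderTop_C_add hc' hU, zero_add]
    exact hR₁
  have t4 : (((p : ℚ) * e : ℚ) : WithTop ℚ) < (-R₂).orderTop := by
    rw [HahnSeries.orderTop_neg]; exact hR₂
  have hRgt : (((p : ℚ) * e : ℚ) : WithTop ℚ) <
      (Δ₀ * Yp + U * HahnSeries.single ((p : ℚ) * e) (u₁ ^ p) +
        ((HahnSeries.C c' + U) * R₁ + -R₂)).orderTop :=
    lt_orderTop_add (lt_orderTop_add hT t2) (lt_orderTop_add t3 t4)
  rw [← key, hL] at hRgt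
  exact lt_irrefl _ hRgt

end PCuspOrders

section PCuspFrob

variable {k : Type} [Field k]

/-- `CharP` for the Hahn field over `k`. -/
theorem pc_charP_hahn (p : ℕ) [CharP k p] : CharP (HahnSeries ℚ k) p :=
  charP_of_injective_algebraMap (algebraMap k (HahnSeries ℚ k)).injective p

/-- `v x > a`, `n ≠ 0` ⟹ `v (x ^ n) > n a`. -/
theorem pc_lt_orderTop_pow {x : HahnSeries ℚ k} {a : ℚ} (hx : (a : WithTop ℚ) < x.orderTop) {n : ℕ}
    (hn : n ≠ 0) : (((n : ℚ) * a : ℚ) : WithTop ℚ) < (x ^ n).orderTop := by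
  by_cases h0 : x = 0
  · rw [h0, zero_pow hn, HahnSeries.orderTop_zero]; exact WithTop.coe_lt_top _
  · have hq : x.orderTop = (x.order : WithTop ℚ) := (HahnSeries.order_eq_orderTop_of_ne_zero h0).symm
    rw [pc_orderTop_pow, hq, ← WithTop.coe_nsmul, WithTop.coe_lt_coe, nsmul_eq_mul]
    rw [hq, WithTop.coe_lt_coe] at hx
    have hn' : (0 : ℚ) < n := by exact_mod_cast Nat.pos_of_ne_zero hn
    exact mul_lt_mul_of_pos_left hx hn'

/-- **The Frobenius identity along the `p`-cusp family.** For elements `P₀, P₁, P₂` of a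
`k`-algebra with `P₂^p = (P₀ + c^p) · P₁^p` (`char k = p`) and two `k`-algebra maps `α, β` to the
Hahn field: `(α P₂ - β P₂)^p = (α P₀ - β P₀) · (α P₁)^p + (C c^p + β P₀) · (α P₁ - β P₁)^p`. -/
theorem pc_frob : ∀ {k : Type} [Field k] (p : ℕ) [Fact p.Prime] [CharP k p] {A : Type} [CommRing A] [Algebra k A] (P₀ P₁ P₂ : A) (c : k), P₂ ^ p = (P₀ + algebraMap k A (c ^ p)) * P₁ ^ p → ∀ (α β : A →ₐ[k] HahnSeries ℚ k), (α P₂ - β P₂) ^ p = (α P₀ - β P₀) * (α P₁) ^ p + (HahnSeries.C (c ^ p) + β P₀) * (α P₁ - β P₁) ^ p := by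
  intro k _ p _ _ A _ _ P₀ P₁ P₂ c hrel α β
  haveI := pc_charP_hahn (k := k) p
  have hα : (α P₂) ^ p = (α P₀ + (HahnSeries.C c) ^ p) * (α P₁) ^ p := by
    have h := congrArg α hrel
    simp only [map_pow, map_mul, map_add, AlgHom.commutes, arcEquiv_algebraMap_eq_C] at h
    exact h
  have hβ : (β P₂) ^ p = (β P₀ + (HahnSeries.C c) ^ p) * (β P₁) ^ p := by
    have h := congrArg β hrel
    simp only [map_pow, map_mul, map_add, AlgHom.commutes, arcEquiv_algebraMap_eq_C] at h
    exact h
  rw [show (HahnSeries.C (c ^ p) : HahnSeries ℚ k) = (HahnSeries.C c) ^ p from map_pow _ _ _,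
    sub_pow_char, sub_pow_char, hα, hβ]
  ring

end PCuspFrob

end Summit.ResolutionOfSingularities.ResolutionOfSingularities.Theorems

end
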